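import Summits.BirchSwinnertonDyer.BirchSwinnertonDyer.Theorems.GenusKolyvaginAtTwoGenusPrimitiveSupplyAtTwoPosDiscShallowOfItems
import HarnessLib

/-!
# SKELETON «strict_def2» v2 (LINE 24, ideator bsd-idea-1 g24) FOR THE RESTATED RESIDUAL ITEM `OffCutResidualAtTwoR` (stmt-BirchSwinnertonDyer-31702; was `OffCutResidualAtTwo` 25503 until rev 57)
# — the STRICT slice S3 (Δ>0, `#Sel₂(E) = 4`, every Selmer class trivial at `ℝ`) is NOT residual for the genus method:
# it carries 2-Selmer-minimal Heegner twins of Tamagawa DEFECT 2 (instrument STRICT-DEF2, job j339253: 189/189 cells, N < 5·10⁵).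

Composition `OffCutResidualAtTwoR_of` concludes the ROUTE DECL `OffCutResidualAtTwoR` BY NAME from FIVE stubs and route ITEMS displayed as hypotheses
(the item form of LEAD gk2-p1's p760906 / p761509); `sorry` ONLY inside the five `stub_*`.  **BSD is NOT proved by this; no item is closed by it;
nothing here is a theorem of the tree until landed.**  NOT registered with `ledger skeleton check` (W-79; 25503 is a declared residual — adoption is the
director's / pen's decision via a rev-54 edit, see the line card `strict_def2.md`).

THE LINE.  On a STRICT cell the shallow convention (`ord₂ c(Wd) = 0`, all primes of `d_K` silent) cannot produce a minimal twin (Mazur–Rubin at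
`T = {∞}` raises `dim Sel₂` from 2 to 3, kernel p755596).  A DEFECT-2 Heegner field does: `d_K` odd with exactly one IDENTITY prime `q`
(`E[2] ⊂ E(𝔽_q)`, `ord₂ c_q(Wd) = 2`) or two TRANSPOSITION primes, the rest silent; the Lagrangian count at `T = {∞, q}` gives `dim Sel₂(E^{d_K}) ∈ {1,3,5}`
and `= 1` is forced when the two Selmer classes of `E` restrict to a basis of `E(ℚ_q)/2` (Chebotarev: density 3/8 among identity primes).  With such a
twin the GK2 chain runs BY NAME — `ExactDescentAtTwo` (22138) and `MinimalTwinBSDTwo` (22985) carry no Tamagawa clause, `c(E/K)` stays odd (the ramified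
prime of `K` is a prime of good reduction), so Kolyvagin exactness `#Ш(E/K)[2^∞] = 4^{M₀}` is BSD₂(E/K) at defect 2 as at defect 0 — except at two typed
places: the supply must output `ord₂ c(Wd) = 2` (stub A⁼², print-reachable) and Q4_T′ must hold at defect 2 (stub X⁼²; its lower half is the same
transposition-deep Kolyvagin-family argument as L⁺_T′, its upper half is NOT by name from the cut: the pair-sandwich budget is stated at defect 0).
The beyond-print kernel is stub C⁼² = K₄⁺-class transposition-deep `2`-primitivity at positive depth (`M₀ ≥ 1` holds on every STRICT cell by B2Q since
`Ш(E)[2] ≠ 0`; depth zero is closed in the composition by `n = 1` anyway).  The two residual stubs R₁ (no odd multiplicative prime) and R₂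
(`#Sel₂(E) ∉ {1, 4}`) are the HONEST remainder, now SIGN-FREE; they are slices of the crux, not lemmas, and are what a rev-54 `OffCutResidualAtTwoR` would say.

References: [Kramer1981] Thm. 1, Prop. 3; [MazurRubin2010] §3 (Prop. 3.3, Cor. 3.4); [GrossZagier1986] Thm. I.6.3 with V.§2; [GrossLMS1991] §3 (3.3)–(3.5),
§4 (4.1); [McCallumLMS1991] §5; [Kolyvagin1989Izv] Thm. B₂; [WZhang2014] Thm. 1.1 (p ≥ 5 only); [DokchitserDokchitserAnnals2010] Thm. 1.4.
-/

set_option autoImplicit false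
set_option linter.dupNamespace false -- `Summit.<P>.<Sub>` repeats `BirchSwinnertonDyer` (D-0017)

noncomputable section

open scoped Classical

namespace Summit.BirchSwinnertonDyer.BirchSwinnertonDyer.Cruxes.OffCutResidualAtTwoR.StrictDef2

open WeierstrassCurve NumberField Literature.NumberTheory.EllipticCurves Literature.NumberTheory.EllipticCurves.ModularForms
  Literature.NumberTheory.GaloisRepresentations
  Summit.BirchSwinnertonDyer.BirchSwinnertonDyer.Theses.GenusKolyvaginAtTwo
  Summit.BirchSwinnertonDyer.BirchSwinnertonDyer.Theorems
  Summit.BirchSwinnertonDyer.BirchSwinnertonDyer.Theorems.GenusKoly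

/-! ## §1 The five stubs -/

/-- STUB A⁼² — DEFECT-2 MINIMAL-TWIN SUPPLY ON THE STRICT CELL (`Δ > 0`, `#Sel₂(E) = 4`, every Selmer class trivial at `ℝ`): a Kolyvagin-(H2)-admissible
Heegner field `K` (odd `d_K ≠ −3`, the two Theorem-B₂ non-square clauses) and a globally minimal twin `Wd ≅ E^{(d_K)}` with `#Sel₂(Wd) = 2` and
`ord₂ c(Wd) = 2`.  PRINT-REACHABLE (no analytic rank, no Heegner point): Chebotarev in `ℚ(E[2], ζ₈, √p : p ∣ N)·M_{c₁,c₂}` for an identity prime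
`q ≡ 7 (8)` at which the two Selmer classes restrict to a basis of `E(ℚ_q)/2`, then the Lagrangian count at `T = {∞, q}` (Kramer / Mazur–Rubin) and
Kramer's twin Tamagawa formula (`padicValNat_two_tamagawaProduct_twin_eq`).  Template: gk2-p3's `exists_allSilent_heegnerField_twin_of_realNarrow`.
Instrument row that would refute it: a STRICT cell with no minimal DEFECT-2 Heegner twin — STRICT-DEF2 j339253 finds one on 189/189 cells (|d_K| ≤ 503).
[cite: Kramer1981, Thm. 1 and Prop. 3] [cite: MazurRubin2010, Prop. 3.3, Cor. 3.4] [cite: SerreAbelianLadic1968, Ch. I §2.2] -/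
theorem stub_minimalTwinSupplyAtTwoPosStrict :
  ∀ (W : WeierstrassCurve ℚ) [W.IsElliptic] [W.IsGloballyMinimal] [NeZero (W.conductorNorm ℤ)],
      ¬ W.HasCM → W.analyticRank = 0 → (∀ n : ℕ, 0 < n → W.HasSurjectiveModNGaloisRep ((2 : ℤ) ^ n)) →
      Odd W.tamagawaProduct → 0 < W.Δ →
      (Nat.card (W.selmerGroup 2) = 4 ∧ ∀ c ∈ (W.kummerSelmerStructure ((2 : ℕ) : ℤ)).selmerGroup, Literature.NumberTheory.GaloisRepresentations.galoisCohomology.localization (W.torsionGaloisModule ((2 : ℕ) : ℤ)) (Sum.inl Rat.infinitePlace) 1 c = 0) →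
      ∃ (K : Type) (_ : Field K) (_ : NumberField K),
        IsImaginaryQuadratic K ∧ Odd (NumberField.discr K) ∧ NumberField.discr K ≠ -3 ∧
        SatisfiesHeegnerHypothesis (W.conductorNorm ℤ) K ∧
        ¬ IsSquare ((NumberField.discr K : ℚ) * -|W.Δ|) ∧ ¬ IsSquare ((NumberField.discr K : ℚ) * (-(2 * |W.Δ|))) ∧
        ∃ (Wd : WeierstrassCurve ℚ) (_ : Wd.IsElliptic) (_ : Wd.IsGloballyMinimal),
          (∃ C : WeierstrassCurve.VariableChange ℚ, C • W.quadraticTwist (NumberField.discr K : ℚ) = Wd) ∧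
          Nat.card (Wd.selmerGroup 2) = 2 ∧ padicValNat 2 Wd.tamagawaProduct = 2
    := by
  sorry

/-- STUB C⁼² — TRANSPOSITION-DEEP `2`-PRIMITIVITY AT POSITIVE DEPTH ON THE DEFECT-2 CONFIGURATION (the heart; K₄⁺-class, BEYOND PRINT: W. Zhang 2014 is
`p ≥ 5`).  Same shape as the registered C⁺‴ `GenusSupplyPos.stub_genusPrimitivityAtTwoPos` of skeleton «genus_supply_pos_shallow» v2 with the real-narrow
Selmer hypothesis replaced by the STRICT one and `ord₂ c(Wd) = 0` by `= 2`: given every binder the composition holds (habitat, `0 < Δ`, STRICT, the field,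
the odd-Manin datum, the conductor-`1` datum with `y_K` of infinite order, McCallum's `M₀` with both divisibility clauses and `1 ≤ M₀`, the defect-2 twin
with `r_an = 1`, `#Sel₂ = 2`), SOME square-free product `n` of Kolyvagin primes of index `≥ 2` whose Frobenius MOVES a point of `E[2]` carries a datum with
`P(n) ∉ 2E(K[n])`.  Why it might fail: it is Kolyvagin's conjecture at `p = 2` in transposition-deep form; no print engine.
[cite: GrossLMS1991, §3 (3.5), §4 (4.1)] [cite: WZhang2014, Thm. 1.1] [cite: Kolyvagin1991MathAnn, Conj. A] -/
theorem stub_genusPrimitivityAtTwoPosStrict :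
  ∀ (W : WeierstrassCurve ℚ) [W.IsElliptic] [W.IsGloballyMinimal] [NeZero (W.conductorNorm ℤ)],
      ¬ W.HasCM → W.analyticRank = 0 → (∀ n : ℕ, 0 < n → W.HasSurjectiveModNGaloisRep ((2 : ℤ) ^ n)) →
      Odd W.tamagawaProduct → 0 < W.Δ →
      (Nat.card (W.selmerGroup 2) = 4 ∧ ∀ c ∈ (W.kummerSelmerStructure ((2 : ℕ) : ℤ)).selmerGroup, Literature.NumberTheory.GaloisRepresentations.galoisCohomology.localization (W.torsionGaloisModule ((2 : ℕ) : ℤ)) (Sum.inl Rat.infinitePlace) 1 c = 0) →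
      ∀ (K : Type) [Field K] [NumberField K],
      IsImaginaryQuadratic K → Odd (NumberField.discr K) → NumberField.discr K ≠ -3 →
      SatisfiesHeegnerHypothesis (W.conductorNorm ℤ) K →
      ¬ IsSquare ((NumberField.discr K : ℚ) * -|W.Δ|) → ¬ IsSquare ((NumberField.discr K : ℚ) * (-(2 * |W.Δ|))) →
      ∀ (Dt : ModularParametrizationData W (W.conductorNorm ℤ)),
      (∀ z ∈ Dt.L.lattice, ∃ w ∈ periodLattice Dt.f, z = (Dt.c : ℂ) * w) → Odd Dt.c →
      ∀ (β : ℤ) (ι : K →+* ℂ) (d₁ : KolyvaginHeegnerData Dt β ι 1), ¬ IsOfFinAddOrder d₁.derivedPoint →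
      ∀ (M₀ : ℕ), (∃ Q : (W.baseChange (ringClassField K ι 1)).toAffine.Point, ((2 ^ M₀ : ℕ) : ℤ) • Q = d₁.derivedPoint) →
      (¬ ∃ Q : (W.baseChange (ringClassField K ι 1)).toAffine.Point, ((2 ^ (M₀ + 1) : ℕ) : ℤ) • Q = d₁.derivedPoint) →
      1 ≤ M₀ →
      ∀ (Wd : WeierstrassCurve ℚ) [Wd.IsElliptic] [Wd.IsGloballyMinimal],
      (∃ C : WeierstrassCurve.VariableChange ℚ, C • W.quadraticTwist (NumberField.discr K : ℚ) = Wd) →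
      Wd.analyticRank = 1 → Nat.card (Wd.selmerGroup 2) = 2 → padicValNat 2 Wd.tamagawaProduct = 2 →
      ∃ (n : ℕ) (d : KolyvaginHeegnerData Dt β ι n), Squarefree n ∧
        (∀ ℓ ∈ n.primeFactors, Zhang2014.IsKolyvaginPrime (W.conductorNorm ℤ) W K 2 ℓ ∧ 2 ≤ Zhang2014.kolyvaginIndex W 2 ℓ ∧
          ∃ (v : IsDedekindDomain.HeightOneSpectrum (NumberField.RingOfIntegers ℚ)) (𝔓 : Ideal (Literature.NumberTheory.GaloisRepresentations.absIntegers (NumberField.RingOfIntegers ℚ) ℚ)) (h : Field.absoluteGaloisGroup ℚ), ((ℓ : ℕ) : NumberField.RingOfIntegers ℚ) ∈ v.asIdeal ∧ 𝔓 ∈ v.primesAbove ∧ IsArithFrobAt (NumberField.RingOfIntegers ℚ) h 𝔓 ∧ ∃ u : W.geomTorsion ((2 : ℕ) : ℤ), h • u ≠ u) ∧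
        ¬ ∃ Q : (W.baseChange (ringClassField K ι n)).toAffine.Point, (2 : ℤ) • Q = d.derivedPoint
    := by
  sorry

/-- STUB X⁼² — KOLYVAGIN EXACTNESS ON THE Δ>0 CUT AT TAMAGAWA DEFECT 2: VERBATIM the route item Q4_T′ `KolyvaginExactAtTwoPosDiscT`
(stmt-BirchSwinnertonDyer-24881 text, rev 53) with the single clause `padicValNat 2 Wd.tamagawaProduct = 0` replaced by `= 2`.  TRUE UNDER BSD exactly as
at defect 0 (`c(E/K) = c(E)²` is odd: the ramified prime of `K` is good for `E`; `u_K = 1`; odd Manin constant) — it IS BSD₂(E/K) in Kolyvagin's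
normalisation.  Lower half (`4^{M₀} ∣ #Ш(E/K)[2^∞]`): the road (E4)⁺ of L⁺_T′ (transposition-deep families; the defect enters only the frame).  Upper half:
NOT by name — the pair-sandwich budget `relIndex_mul_relIndex_le_four_of_padicValNat_eq_zero` is stated at defect 0; at an identity prime `q` the budget
splits into case A (`loc_q Sel₂(E) = E(ℚ_q)/2`: `Sel` strict at `q` vanishes, nothing capitulates) and case B (one `ℤ/2 ⊂ Ш(E)[2]` is locally trivial at
`q` and is the Kummer class of the twin's generator: it capitulates in `K`, Kramer's class).  Why it might fail: the defect-2 budget may cost one factor 4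
in the tree's sandwich (then only `#Ш(E/K)[2^∞] ∣ 4^{M₀+1}` closes by name and the sharp bound needs Kolyvagin's structure theorem at 2).
[cite: Kolyvagin1989Izv, Thm. B₂] [cite: Kramer1981, Thm. 1, Prop. 3] [cite: McCallumLMS1991, §5 Thm. 5.4, Cor. 5.6] [cite: GrossLMS1991, §3] -/
theorem stub_kolyvaginExactAtTwoPosDiscDefectTwo :
  KolyvaginRelationAtTwo → ∀ (W : WeierstrassCurve ℚ) [W.IsElliptic] [W.IsGloballyMinimal] [NeZero (W.conductorNorm ℤ)], ¬ W.HasCM → Odd W.tamagawaProduct → ∀ (v : IsDedekindDomain.HeightOneSpectrum (NumberField.RingOfIntegers ℚ)), ((2 : ℕ) : NumberField.RingOfIntegers ℚ) ∉ v.asIdeal → ((W.conductorNorm ℤ : ℕ) : NumberField.RingOfIntegers ℚ) ∈ v.asIdeal → W.HasMultiplicativeReductionAt v → 0 < W.Δ → ∀ (K : Type) [Field K] [NumberField K], Literature.NumberTheory.EllipticCurves.IsImaginaryQuadratic K → Odd (NumberField.discr K) → NumberField.discr K ≠ -3 → Literature.NumberTheory.EllipticCurves.SatisfiesHeegnerHypothesis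 (W.conductorNorm ℤ) K → ¬ IsSquare ((NumberField.discr K : ℚ) * -|W.Δ|) → ¬ IsSquare ((NumberField.discr K : ℚ) * (-(2 * |W.Δ|))) → (∀ n : ℕ, 0 < n → W.HasSurjectiveModNGaloisRep ((2 : ℤ) ^ n)) → ∀ (Dt : Literature.NumberTheory.EllipticCurves.ModularForms.ModularParametrizationData W (W.conductorNorm ℤ)) (β : ℤ) (ι : K →+* ℂ) (d₁ : Literature.NumberTheory.EllipticCurves.KolyvaginHeegnerData Dt β ι 1), ¬ IsOfFinAddOrder d₁.derivedPoint → ∀ (M₀ : ℕ), (∃ Q : (W.baseChange (Literature.NumberTheory.EllipticCurves.ringClassField K ι 1)).toAffine.Point, ((2 ^ M₀ : ℕ) : ℤ) • Q = d₁.derivedPoint) → (¬ ∃ Q : (W.baseChange (Literature.NumberTheory.EllipticCurves.ringClassField K ι 1)).toAffine.Point, ((2 ^ (M₀ + 1) : ℕ) : ℤ) • Q = d₁.derivedPoint) → W.rootNumber = 1 → ∀ (Wd : WeierstrassCurve ℚ) [Wd.IsElliptic] [Wd.IsGloballyMinimal], (∃ C : WeierstrassCurve.VariableChange ℚ, C •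 W.quadraticTwist (NumberField.discr K : ℚ) = Wd) → Nat.card (Wd.selmerGroup 2) = 2 → padicValNat 2 Wd.tamagawaProduct = 2 → ∀ (n : ℕ) (d : Literature.NumberTheory.EllipticCurves.KolyvaginHeegnerData Dt β ι n), Squarefree n → (∀ ℓ ∈ n.primeFactors, Literature.NumberTheory.EllipticCurves.Zhang2014.IsKolyvaginPrime (W.conductorNorm ℤ) W K 2 ℓ ∧ 2 ≤ Literature.NumberTheory.EllipticCurves.Zhang2014.kolyvaginIndex W 2 ℓ ∧ ∃ (v : IsDedekindDomain.HeightOneSpectrum (NumberField.RingOfIntegers ℚ)) (𝔓 : Ideal (Literature.NumberTheory.GaloisRepresentations.absIntegers (NumberField.RingOfIntegers ℚ) ℚ)) (h : Field.absoluteGaloisGroup ℚ), ((ℓ : ℕ) : NumberField.RingOfIntegers ℚ) ∈ v.asIdeal ∧ 𝔓 ∈ v.primesAbove ∧ IsArithFrobAt (NumberField.RingOfIntegers ℚ) h 𝔓 ∧ ∃ u : W.geomTorsion ((2 : ℕ) : ℤ), h • u ≠ u) → (¬ ∃ Q : (W.baseChange (Literature.NumberTheory.EllipticCurves.ringClassField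 K ι n)).toAffine.Point, (2 : ℤ) • Q = d.derivedPoint) → Nat.card (AddCommGroup.primaryComponent (W.baseChange K).sha 2) = 2 ^ (2 * M₀)
    := by
  sorry

/-- STUB R₁′ — RESIDUAL SLICE (declared residual, NOT a lemma of the line; sign-free): habitat curves with NO odd prime of multiplicative reduction AND
`#Sel₂(E) ≠ 1` (rev 57: the depth-zero additive-only cells left the residual with LINE 25 «s1_depth_zero»).
WHY NO ENGINE: every exactness item binds an odd multiplicative prime `v`, the non-phantom input of B2Q/B2Q⁺ (Lawson–Wuthrich everywhere-Selmer
phantoms; at v = 2 only u² is available and the LW class IS a phantom on ⟨u²⟩ — memo V2-PHANTOM-g24).  VERBATIM the first disjunct of `OffCutResidualAtTwoR`. [cite: LawsonWuthrich2016, Thm. 1.1] -/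
theorem stub_residualAdditiveNontrivialSelmerAtTwo :
  ∀ (W : WeierstrassCurve ℚ) [W.IsElliptic] [W.IsGloballyMinimal] [NeZero (W.conductorNorm ℤ)], ¬ W.HasCM → W.analyticRank = 0 → (∀ n : ℕ, 0 < n → W.HasSurjectiveModNGaloisRep ((2 : ℤ) ^ n)) → Odd W.tamagawaProduct → (∃ Dt : Literature.NumberTheory.EllipticCurves.ModularForms.ModularParametrizationData W (W.conductorNorm ℤ), (∀ z ∈ Dt.L.lattice, ∃ w ∈ Literature.NumberTheory.EllipticCurves.ModularForms.periodLattice Dt.f, z = (Dt.c : ℂ) * w) ∧ Odd Dt.c) → (¬ (∃ v : IsDedekindDomain.HeightOneSpectrum (NumberField.RingOfIntegers ℚ), ((2 : ℕ) : NumberField.RingOfIntegers ℚ) ∉ v.asIdeal ∧ ((W.conductorNorm ℤ : ℕ) : NumberField.RingOfIntegers ℚ) ∈ v.asIdeal ∧ W.HasMultiplicativeReductionAt v)) ∧ Nat.card (W.selmerGroup 2) ≠ 1 → Literature.NumberTheory.EllipticCurves.BSDp W 2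
    := by
  sorry

/-- STUB R₂ — RESIDUAL SLICE (declared residual, NOT a lemma of the line; SIGN-FREE): habitat curves with `#Sel₂(E) ∉ {1, 4}` (the WIDE Selmer cells:
`dim Sel₂(E) ≥ 4`; on Δ>0 EMPTY for N < 5·10⁵, ACCT-S3-g22; on Δ<0 = the 2nd disjunct of `OffCutResidualAtTwoR`).  WHY NO ENGINE: a minimal twin needs
`ρ_α ≥ dim Sel₂(E) − 1 ≥ 3 > h_∞ + h_q`. [cite: MazurRubin2010, Prop. 3.3] -/
theorem stub_residualWideSelmerAtTwo :
  ∀ (W : WeierstrassCurve ℚ) [W.IsElliptic] [W.IsGloballyMinimal] [NeZero (W.conductorNorm ℤ)], ¬ W.HasCM → W.analyticRank = 0 → (∀ n : ℕ, 0 < n → W.HasSurjectiveModNGaloisRep ((2 : ℤ) ^ n)) → Odd W.tamagawaProduct → (∃ Dt : Literature.NumberTheory.EllipticCurves.ModularForms.ModularParametrizationData W (W.conductorNorm ℤ), (∀ z ∈ Dt.L.lattice, ∃ w ∈ Literature.NumberTheory.EllipticCurves.ModularForms.periodLattice Dt.f, z = (Dt.c : ℂ) * w) ∧ Odd Dt.c)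 → (¬ (Nat.card (W.selmerGroup 2) = 1 ∨ Nat.card (W.selmerGroup 2) = 4)) → Literature.NumberTheory.EllipticCurves.BSDp W 2
    := by
  sorry

/-! ## §2 Composition: `OffCutResidualAtTwoR` BY NAME from the five stubs and ELEVEN route items displayed as hypotheses -/

/-- COMPOSITION (sorry-free outside the five stubs).  The three disjuncts of the residual hypothesis: (S1) no odd multiplicative prime → R₁; (S2) Δ<0
wide → R₂; (S3) Δ>0 and not real-narrow: either `#Sel₂(E) ∉ {1,4}` → R₂, or no odd multiplicative prime → R₁, or the STRICT cell → A⁼² gives `K` and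
the defect-2 minimal twin; the twin is non-CM with `Wd(ℚ)[2] = 0`, `w(Wd) = −1` (Modularity), odd corank (2-parity), corank 1, `r_an(Wd) = 1` (the two
converse items) — gk2-p1's `stubA_pos_of_items` verbatim; the habitat's odd-Manin datum, `β`, `ι`, `d₁`; `y_K` of infinite order from Gross–Zagier at the
pair; McCallum's `M₀`; the transposition-deep witness (depth 0 free, positive depth C⁼²); `w(E) = +1` from `r_an(E) = 0`; X⁼² gives
`#Ш(E/K)[2^∞] = 4^{M₀}`; BSD₂(Wd) from `MinimalTwinBSDTwo` (no Tamagawa clause); `ExactDescentAtTwo` (from its four facts; no Tamagawa clause) descends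
to BSD₂(E).  Route items used BY NAME: GrossZagierAllLevels, ModularityExistsNewform, TwoParityDD, RankOneTwoConverse,
RankOneTwoConverseOffSemistableAtTwo, KolyvaginRelationAtTwo, ExactDescentAtTwoOfFourFacts, MinimalTwinBSDTwo, EntireLFunctionRat,
MultPublishedInputsAtTwo, MilneAnyModel.  BSD is NOT proved by this. -/
theorem OffCutResidualAtTwoR_of (hGZ : GrossZagierAllLevels) (hmod : ModularityExistsNewform) (hpar : TwoParityDD)
    (hconv : RankOneTwoConverse) (hconv' : RankOneTwoConverseOffSemistableAtTwo) (hQ2 : KolyvaginRelationAtTwo)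
    (hGf : ExactDescentAtTwoOfFourFacts) (hTw : MinimalTwinBSDTwo) (hL : EntireLFunctionRat) (hGZK : MultPublishedInputsAtTwo)
    (hMi : MilneAnyModel) :
    OffCutResidualAtTwoR := by
  have hG : ExactDescentAtTwo := hGf ⟨hGZ, hGZK, hL, hMi⟩
  intro W _ _ _ hcm hr0 hρ hT hopt hslice
  rcases hslice with hadd | ⟨hneg, hwide⟩ | ⟨hpos, h14⟩
  · exact stub_residualAdditiveNontrivialSelmerAtTwo W hcm hr0 hρ hT hopt hadd
  · exact stub_residualWideSelmerAtTwo W hcm hr0 hρ hT hopt hwide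
  · by_cases hmult : ∃ v : IsDedekindDomain.HeightOneSpectrum (NumberField.RingOfIntegers ℚ),
        ((2 : ℕ) : NumberField.RingOfIntegers ℚ) ∉ v.asIdeal ∧
        ((W.conductorNorm ℤ : ℕ) : NumberField.RingOfIntegers ℚ) ∈ v.asIdeal ∧ W.HasMultiplicativeReductionAt v
    swap
    · exact stub_residualAdditiveNontrivialSelmerAtTwo W hcm hr0 hρ hT hopt ⟨hmult, fun h1 => h14 (Or.inl h1)⟩
    by_cases h4 : Nat.card (W.selmerGroup 2) = 4
    swap
    · exact stub_residualWideSelmerAtTwo W hcm hr0 hρ hT hopt (by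
        rintro (h1 | h4')
        · exact h14 (Or.inl h1)
        · exact h4 h4')
    -- the STRICT cell
    have hstrict : ∀ c ∈ (W.kummerSelmerStructure ((2 : ℕ) : ℤ)).selmerGroup,
        galoisCohomology.localization (W.torsionGaloisModule ((2 : ℕ) : ℤ)) (Sum.inl Rat.infinitePlace) 1 c = 0 := by
      intro c hc
      by_contra hne
      exact h14 (Or.inr ⟨h4, c, hc, hne⟩)
    obtain ⟨v, h2v, hNv, hmv⟩ := hmult
    -- A⁼²: the field and the defect-2 minimal twin
    obtain ⟨K, iF, iN, hIQ, hodd, h3, hHe, hsq1, hsq2, Wd, iE, iM, hWd, hSel, hDEF⟩ :=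
      stub_minimalTwinSupplyAtTwoPosStrict W hcm hr0 hρ hT hpos ⟨h4, hstrict⟩
    have hd0 : (NumberField.discr K : ℚ) ≠ 0 := by exact_mod_cast NumberField.discr_ne_zero K
    haveI := W.isElliptic_quadraticTwist hd0
    -- r_an(Wd) = 1: non-CM, no rational 2-torsion, root number −1, odd corank, corank 1, the converse (gk2-p1 `stubA_pos_of_items`)
    have hcmd : ¬ Wd.HasCM := twin_not_hasCM W hcm hd0 Wd hWd
    have htors := natCard_twoTorsion_twin_eq_one W (by simpa using hρ 1 one_pos) hd0 Wd hWd
    have hwd := rootNumber_twin_eq_neg_one hmod W hr0 K hIQ hHe Wd hWd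
    have hco := selmerCorank_two_eq_one_of_card_selmerGroup_two Wd htors hSel (odd_selmerCorank_two_of_p_parity Wd (hpar Wd) hwd)
    have hrd : Wd.analyticRank = 1 := by
      by_cases h : (Rank1Residual.GoodOrd Wd 2 ∨ Rank1Residual.Mult Wd 2)
      · exact hconv Wd hcmd h hco
      · exact hconv' Wd hcmd h hco
    have hrtw : (W.quadraticTwist (NumberField.discr K : ℚ)).analyticRank = 1 := by
      obtain ⟨C, hC⟩ := hWd
      rw [← analyticRank_smul (W.quadraticTwist (NumberField.discr K : ℚ)) C, hC]
      exact hrd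
    -- the habitat's odd-Manin datum; orientation, embedding, conductor-`1` datum
    obtain ⟨Dt, hoptDt, hc⟩ := hopt
    obtain ⟨β, hβ⟩ : ∃ β : ℤ, (4 * (W.conductorNorm ℤ : ℕ) : ℤ) ∣ β ^ 2 - NumberField.discr K :=
      Literature.NumberTheory.QuadraticFields.Quadratic.exists_dvd_sq_sub_discr_of_ncard_primesOver hIQ.1 (NeZero.ne _) hHe
    obtain ⟨ι⟩ : Nonempty (K →+* ℂ) := inferInstance
    obtain ⟨d₁⟩ := exists_kolyvaginHeegnerData_one
      (phi_heegnerTau_mem_singularModuliField_holds (W.conductorNorm ℤ) W K) hIQ Dt β ι hβ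
    -- y_K of infinite order (Gross–Zagier at the pair), McCallum's exponent
    have hy : ¬ IsOfFinAddOrder d₁.derivedPoint :=
      stub_heegnerNonTorsionAtTwo_pair_of_grossZagier W K (hGZ _ W K) hIQ hHe hr0 hrtw Dt β ι d₁
    obtain ⟨M₀, hdiv, hndiv⟩ := exists_exactTwoDivisibility_of_not_isOfFinAddOrder W hIQ Dt β ι d₁ hy
    -- the transposition-deep witness: free at depth 0, C⁼² at positive depth
    obtain ⟨n, d, hn, hKoly, hPn⟩ : ∃ (n : ℕ) (d : KolyvaginHeegnerData Dt β ι n), Squarefree n ∧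
        (∀ ℓ ∈ n.primeFactors, Zhang2014.IsKolyvaginPrime (W.conductorNorm ℤ) W K 2 ℓ ∧ 2 ≤ Zhang2014.kolyvaginIndex W 2 ℓ ∧
          ∃ (v : IsDedekindDomain.HeightOneSpectrum (NumberField.RingOfIntegers ℚ)) (𝔓 : Ideal (Literature.NumberTheory.GaloisRepresentations.absIntegers (NumberField.RingOfIntegers ℚ) ℚ)) (h : Field.absoluteGaloisGroup ℚ), ((ℓ : ℕ) : NumberField.RingOfIntegers ℚ) ∈ v.asIdeal ∧ 𝔓 ∈ v.primesAbove ∧ IsArithFrobAt (NumberField.RingOfIntegers ℚ) h 𝔓 ∧ ∃ u : W.geomTorsion ((2 : ℕ) : ℤ), h • u ≠ u) ∧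
        ¬ ∃ Q : (W.baseChange (ringClassField K ι n)).toAffine.Point, (2 : ℤ) • Q = d.derivedPoint := by
      rcases Nat.eq_zero_or_pos M₀ with hM | hM
      · subst hM
        exact GenusSupplyNarrow.exists_deepWitness_of_depth_zero W Dt β ι d₁ _ hndiv
      · exact stub_genusPrimitivityAtTwoPosStrict W hcm hr0 hρ hT hpos ⟨h4, hstrict⟩ K hIQ hodd h3 hHe hsq1 hsq2 Dt hoptDt hc β ι d₁ hy
          M₀ hdiv hndiv hM Wd hWd hrd hSel hDEF
    -- w(E) = +1 from r_an(E) = 0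
    have hw : W.rootNumber = 1 :=
      (Literature.Barriers.BirchSwinnertonDyer.even_analyticRank_iff_of_isNewformOf_conductorLevel Dt.isNewformOf).mp (by rw [hr0]; exact Even.zero)
    -- BSD₂ of the twin (no Tamagawa clause), exactness at defect 2, descent
    have hBd : BSDp Wd 2 := hTw Wd hcmd hrd hSel
    exact hG W hcm hr0 hρ hT K hIQ hodd h3 hHe Dt hoptDt hc β ι d₁ hy M₀ hdiv hndiv
      (stub_kolyvaginExactAtTwoPosDiscDefectTwo hQ2 W hcm hT v h2v hNv hmv hpos K hIQ hodd h3 hHe hsq1 hsq2 hρ Dt β ι d₁ hy M₀ hdiv hndiv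
        hw Wd hWd hSel hDEF n d hn hKoly hPn)
      Wd hWd hSel hBd

end Summit.BirchSwinnertonDyer.BirchSwinnertonDyer.Cruxes.OffCutResidualAtTwoR.StrictDef2

end
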